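import Summits.QuantumAdvantage.QuantumAdvantage.Theorems.LinnikCubicClassGroupsPureCubicClassGroupFBQPStubCubicReduction
import Summits.QuantumAdvantage.QuantumAdvantage.Theorems.LinnikCubicClassGroupsPureCubicClassGroupFBQPStubClassTableSemNumerics
import Literature.Computability.Cryptography.CubicClassTableSemWalk
import Literature.Computability.Cryptography.CubicClassTableSemBE
import Literature.NumberTheory.NumberFields.PureCubicDiscriminantBound

/-!
# Crux `LinnikCubicClassGroups.PureCubicClassGroupFBQP` (stmt-QuantumAdvantage-11544) — stub `stub_classTableSem`, part WALK

Line `arakelov-giant-step-cycle`, stub `stub_classTableSem` (S5b-P5b): the WALK PACKAGE of one table position `v` of the ladder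
class table `classTableOpQ` (`Literature/Computability/Cryptography/CubicClassTableLadder.lean`), assembled from the landed
semantics (`CubicClassTableSem{Step,Pow,BE,Ladder,Descend,Walk}.lean`) and the numerics (`…Numerics.lean`): for admissible walk
parameters (`s₀ = 18 KN`, `Tdbl ≥ 6 LD + 16`, `Bb ≥ 32 KN²`, `margin = 0`, regulator advice `|r − 2^k R| ≤ 1`, `cap ≥ (243a²b²)²`)
the final state codes the reduced ideal `β⁻¹ A_E` of a positive relative minimum `β` of `A_E = ∏ 𝔤_t^{e_t}`, at computed position
within an explicit budget of `2^prec log σ₁ β`, with the target `t⋆` in `[pos, pos + l)` for the certified log `l` of the NEXT gap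
(the walk stops just left of `t⋆`), and `t⋆ = t̂ + N·Rint` with `N` within `2 + (3S + 2^prec·2LB·S)/Rint` of the AFFINE main term
`2^prec Σ_t e_t log σ₁ γ_t / Rint` (`walk_package`).
-/

set_option linter.dupNamespace false

namespace Summit.QuantumAdvantage.QuantumAdvantage.Theorems.LinnikCubicClassGroups

open scoped NumberField nonZeroDivisors
open NumberField
open Literature.NumberTheory.CubicFields
open Literature.NumberTheory.CubicFields.PureCubicCodes (Canon Mem)
open Literature.NumberTheory.NumberFields.PureCubic (abs_discr_le ne_zero_of_squarefree_mul)
open Literature.Computability.Cryptography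
open Literature.Computability.Cryptography.CubicClassTable
open Literature.Computability.Cryptography.CubicClassTable.WalkFns

section Walk

variable {K : Type} [Field K] [NumberField K] {θ : K} {σ₁ : K →+* ℝ} {σ₂ : K →+* ℂ} {F : WalkFns} {I : Inst}
variable (hdeg : Module.finrank ℚ K = 3) (hσ₂ : ∃ z : K, starRingEnd ℂ (σ₂ z) ≠ σ₂ z)
  (ε : (𝓞 K)ˣ) (hε : 1 < σ₁ (algebraMap (𝓞 K) K ε))
  (hab : Squarefree (I.a * I.b)) (hab1 : I.a * I.b ≠ 1) (hθ : θ ^ 3 = ((I.a * I.b ^ 2 : ℕ) : K))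
  (hred : RedSem F I.a I.b K θ σ₁ σ₂) (hprod : ProdSpec I.a I.b K θ F.latProd)
  {cap : ℕ} (hcap : (243 * I.a ^ 2 * I.b ^ 2) ^ 2 ≤ cap) (hprec : 4 * Nat.size (I.a * I.b) + 8 ≤ I.prec)
  (hord : Canon I.ord) (hordm : ∀ φ : K, Mem θ I.b I.ord φ ↔ IsIntegral ℤ φ)
  (h6 : ∀ A : FractionalIdeal (𝓞 K)⁰ K, A ≠ 0 → ∀ x₀ ∈ posRelMinima σ₁ σ₂ A, ∀ i : ℤ,
    2 * σ₁ (voronoiChain σ₁ σ₂ A x₀ i) ≤ σ₁ (voronoiChain σ₁ σ₂ A x₀ (i + 6)))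
  (hR6 : Real.log 2 / 6 ≤ Units.regulator K)
  (hs₀ : I.s₀ = 18 * (10 * Nat.size (I.a * I.b) + 48)) (hTdbl : 6 * Nat.size (27 * I.a ^ 2 * I.b ^ 2) + 16 ≤ I.Tdbl)
  (hBb : 32 * (10 * Nat.size (I.a * I.b) + 48) ^ 2 ≤ I.Bb) (hmargin : I.margin = 0)
  (hr : |(I.r : ℝ) - 2 ^ I.k * Units.regulator K| ≤ 1) (hk4 : 4 ≤ I.k) (hks : I.k + I.s ≤ I.prec)

include hdeg hab hab1 hθ hprec in
/-- `11 LB + 1 ≤ KN`, `prec ≥ 9`, `|d_K| ≤ 2^prec`, `|d_K| < 2^LD`. -/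
theorem walk_consts :
    11 * Real.log (3 * Real.sqrt |(discr K : ℝ)|) + 1 ≤ ((10 * Nat.size (I.a * I.b) + 48 : ℕ) : ℝ) ∧ 9 ≤ I.prec ∧
      |(discr K : ℝ)| < 2 ^ Nat.size (27 * I.a ^ 2 * I.b ^ 2) ∧ 0 < |(discr K : ℝ)| := by
  obtain ⟨ha, hb⟩ := ne_zero_of_squarefree_mul hab
  have hd0 : 0 < |(discr K : ℝ)| := by rw [← Int.cast_abs]; exact_mod_cast abs_pos.mpr (discr_ne_zero K)
  have hd27 : |(discr K : ℝ)| ≤ 27 * (I.a : ℝ) ^ 2 * (I.b : ℝ) ^ 2 := by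
    have h := abs_discr_le hdeg hab hab1 hθ
    rw [← Int.cast_abs]; exact_mod_cast h
  obtain ⟨h9, -, hK, -⟩ := walkParams_bounds ha hb hprec hd0 hd27
  refine ⟨?_, h9, ?_, hd0⟩
  · have h2 : (0 : ℝ) < 2 ^ I.prec := by positivity
    push_cast at hK ⊢
    nlinarith
  · calc |(discr K : ℝ)| ≤ ((27 * I.a ^ 2 * I.b ^ 2 : ℕ) : ℝ) := by push_cast; exact hd27
      _ < 2 ^ Nat.size (27 * I.a ^ 2 * I.b ^ 2) := by exact_mod_cast Nat.lt_size_self _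

include hr hk4 hR6 hks in
/-- The period `Rint = r 2^(prec−k)` is positive and `2 Rint ≤ 2^prec (2 R + 2)`; `r > 0`. -/
theorem walk_Rint : 0 < I.r ∧ 0 < I.Rint ∧ 2 * (I.Rint : ℝ) ≤ 2 ^ I.prec * (2 * Units.regulator K + 2) := by
  have hl2 := Real.log_two_gt_d9
  have h2k : (16 : ℝ) ≤ 2 ^ I.k := by
    calc (16 : ℝ) = 2 ^ 4 := by norm_num
      _ ≤ 2 ^ I.k := pow_le_pow_right₀ (by norm_num) hk4
  rw [abs_le] at hr
  have hRk : 16 * (Real.log 2 / 6) ≤ 2 ^ I.k * Units.regulator K :=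
    mul_le_mul h2k hR6 (by positivity) (by positivity)
  have hrpos : (0 : ℝ) < I.r := by nlinarith
  have hr0 : 0 < I.r := by exact_mod_cast hrpos
  refine ⟨hr0, by unfold Inst.Rint; positivity, ?_⟩
  have e : (I.Rint : ℝ) = I.r * 2 ^ (I.prec - I.k) := by unfold Inst.Rint; push_cast; ring
  have e2 : (2 : ℝ) ^ I.prec = 2 ^ (I.prec - I.k) * 2 ^ I.k := by rw [← pow_add]; congr 1; omega
  rw [e, e2]
  have h1 : (I.r : ℝ) ≤ 2 ^ I.k * Units.regulator K + 1 := by linarith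
  have h3 : (0 : ℝ) ≤ 2 ^ (I.prec - I.k) := by positivity
  have hR0 : 0 ≤ Units.regulator K := le_trans (by positivity) hR6
  nlinarith [mul_le_mul_of_nonneg_left h1 h3,
    mul_le_mul_of_nonneg_left (show (1 : ℝ) ≤ 2 ^ I.k by linarith) (by positivity : (0 : ℝ) ≤ 2 ^ (I.prec - I.k))]

include hdeg hσ₂ hε hab hab1 hθ hred hprod hcap hprec hord hordm h6 hR6 hs₀ hTdbl hBb hmargin hr hk4 hks in
/-- **The walk package of a table position.** -/
theorem walk_package (v : ℕ) (𝔤 : ℕ → Ideal (𝓞 K)) (γ : ℕ → K)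
    (hslot : ∀ t < I.T, 𝔤 t ≠ ⊥ ∧ Canon (F.gT I v t) ∧
      (∀ φ : K, Mem θ I.b (F.gT I v t) φ ↔ φ ∈ (𝔤 t : FractionalIdeal (𝓞 K)⁰ K)) ∧
      γ t ∈ (𝔤 t : FractionalIdeal (𝓞 K)⁰ K) ∧ 0 < σ₁ (γ t) ∧ ‖σ₂ (γ t)‖ < 1 ∧
      (∀ φ : K, φ ∈ (𝔤 t : FractionalIdeal (𝓞 K)⁰ K) → 0 < σ₁ φ → ‖σ₂ φ‖ < 1 → σ₁ (γ t) ≤ σ₁ φ)) :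
    ∃ (β : K) (N : ℤ) (n : ℕ),
      β ∈ posRelMinima σ₁ σ₂ (∏ t ∈ Finset.range I.T, (𝔤 t : FractionalIdeal (𝓞 K)⁰ K) ^ I.digit v t) ∧
      Canon (F.cfinq I cap v).1 ∧
      (∀ φ : K, Mem θ I.b (F.cfinq I cap v).1 φ ↔ φ ∈ FractionalIdeal.spanSingleton (𝓞 K)⁰ β⁻¹ *
        ∏ t ∈ Finset.range I.T, (𝔤 t : FractionalIdeal (𝓞 K)⁰ K) ^ I.digit v t) ∧
      (n : ℝ) ≤ 20 * ((10 * Nat.size (I.a * I.b) + 48 : ℕ) : ℝ) ^ 2 ∧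
      |((F.cfinq I cap v).2 : ℝ) - 2 ^ I.prec * Real.log (σ₁ β)| ≤
        3 * (∑ t ∈ Finset.range I.T, (I.digit v t : ℝ)) +
          3 * ((6 * Nat.size (27 * I.a ^ 2 * I.b ^ 2) + 9 : ℕ) + 1) *
            (2 ^ (6 * Nat.size (27 * I.a ^ 2 * I.b ^ 2) + 9) * ((I.s₀ : ℝ) + 1)) + n ∧
      0 ≤ F.tstarc I cap v - (F.cfinq I cap v).2 ∧
      ((F.tstarc I cap v - (F.cfinq I cap v).2 : ℤ) : ℝ) < (F.redc I cap (F.cfinq I cap v).1).2 ∧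
      |((F.redc I cap (F.cfinq I cap v).1).2 : ℝ) - 2 ^ I.prec *
        (Real.log (σ₁ (voronoiSucc σ₁ σ₂ (∏ t ∈ Finset.range I.T, (𝔤 t : FractionalIdeal (𝓞 K)⁰ K) ^ I.digit v t) β)) -
          Real.log (σ₁ β))| ≤ 1 ∧
      F.tstarc I cap v = I.tgt v + N * I.Rint ∧
      |(N : ℝ) - 2 ^ I.prec * (∑ t ∈ Finset.range I.T, (I.digit v t : ℝ) * Real.log (σ₁ (γ t))) / I.Rint| ≤
        2 + (3 * (∑ t ∈ Finset.range I.T, (I.digit v t : ℝ)) +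
          2 ^ I.prec * (2 * Real.log (3 * Real.sqrt |(discr K : ℝ)|)) * (∑ t ∈ Finset.range I.T, (I.digit v t : ℝ))) / I.Rint := by
  set A : FractionalIdeal (𝓞 K)⁰ K := ∏ t ∈ Finset.range I.T, (𝔤 t : FractionalIdeal (𝓞 K)⁰ K) ^ I.digit v t with hA
  set S : ℝ := ∑ t ∈ Finset.range I.T, (I.digit v t : ℝ) with hS
  set KN : ℕ := 10 * Nat.size (I.a * I.b) + 48 with hKN
  set LD : ℕ := Nat.size (27 * I.a ^ 2 * I.b ^ 2) with hLD
  set LB : ℝ := Real.log (3 * Real.sqrt |(discr K : ℝ)|) with hLB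
  set L : ℕ := 6 * LD + 9 with hL
  obtain ⟨hLBKN, h9, hdLD, hd0⟩ := walk_consts hdeg hab hab1 hθ hprec
  obtain ⟨hL0, -⟩ := logB_bounds (K := K)
  obtain ⟨hK1, hK2, hdprec⟩ := Inst.KInt_ge (I := I) hdeg hab hab1 hθ hprec
  obtain ⟨hr0, hRint0, h2Rint⟩ := walk_Rint (I := I) hR6 hr hk4 hks
  have hKIe : (I.KInt : ℝ) = 2 ^ I.prec * KN := by rw [hKN]; unfold Inst.KInt; push_cast; ring
  have hKN48 : 48 ≤ KN := by omega
  have hKN1 : (1 : ℝ) ≤ KN := by exact_mod_cast (show 1 ≤ KN by omega)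
  -- (1) `b_E`
  obtain ⟨αE, hαE, hcE, hmE, honeE, herrE, hdrE⟩ := bEc_sem hdeg hσ₂ hab hab1 hθ hred hprod hcap hprec hord hordm v 𝔤 γ hslot
  rw [← hA] at hmE honeE
  have hA0 : A ≠ 0 := by
    intro h; rw [h, mul_zero] at honeE
    exact one_ne_zero ((FractionalIdeal.mem_zero_iff (𝓞 K)⁰).mp honeE.1.1)
  -- (2) the target
  obtain ⟨N, hN, hlo, hhi⟩ := tstarc_decomp F I cap v hRint0
  have htgt := tgt_lt_Rint I v hr0 hks
  -- (3) the ladder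
  have hp0 : 2 * (I.KInt : ℝ) ≤ (F.ladder I cap 0).2 := by
    obtain ⟨-, -, -, -, herr0⟩ := hbase_sem hdeg hσ₂ ε hε hab hab1 hθ hred hcap hord hordm (F := F) (I := I)
    have h1pos := one_mem_posRelMinima_one (σ₁ := σ₁) (σ₂ := σ₂) hdeg hσ₂
    have hG := log_chain_six_gap (a := fun i => σ₁ (voronoiChain σ₁ σ₂ (1 : FractionalIdeal (𝓞 K)⁰ K) 1 i))
      (fun i => (voronoiChain_mem hdeg hσ₂ ε hε h1pos i).2) (voronoiChain_strictMono hdeg hσ₂ ε hε h1pos).monotone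
      (h6 1 one_ne_zero 1 h1pos) I.s₀
    simp only [voronoiChain_zero, map_one, Real.log_one, sub_zero] at hG
    rw [hs₀] at herr0 hG
    rw [hKIe]
    have := num_hbase_lower (p₀ := ((F.hbase I cap).2 : ℝ)) h9 (by omega : 1 ≤ KN) (by exact_mod_cast herr0) hG
    push_cast at this
    exact this
  have hC : ((F.ladder I cap 0).2 : ℝ) + I.KInt ≤ 2 ^ I.prec * (18 * KN * LB + KN) + 18 * KN := by
    obtain ⟨-, -, -, -, herr0⟩ := hbase_sem hdeg hσ₂ ε hε hab hab1 hθ hred hcap hord hordm (F := F) (I := I)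
    have h1pos := one_mem_posRelMinima_one (σ₁ := σ₁) (σ₂ := σ₂) hdeg hσ₂
    have hup := log_voronoiChain_add_natCast_le hdeg hσ₂ ε hε h1pos 0 I.s₀
    simp only [voronoiChain_zero, map_one, Real.log_one, zero_add] at hup
    rw [abs_le] at herr0
    change ((F.hbase I cap).2 : ℝ) + I.KInt ≤ _
    rw [hKIe]
    have hs0' : (I.s₀ : ℝ) = 18 * KN := by rw [hs₀]; push_cast; ring
    rw [hs0'] at herr0 hup
    have h2p : (0 : ℝ) ≤ 2 ^ I.prec := by positivity
    nlinarith [mul_le_mul_of_nonneg_left hup h2p]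
  -- (4) the descent
  have hLT : L < I.Tdbl := by omega
  have hReg := regulator_le_abs_discr_pow_six K hdeg σ₁ σ₂ hσ₂
  have hlev : ∀ i, L < i → 2 * (I.Rint : ℝ) < (F.ladder I cap i).2 + I.KInt := by
    intro i hi
    obtain ⟨hpi, -⟩ := ladder_growth hdeg hσ₂ ε hε hab hab1 hθ hred hprod hcap hprec hord hordm hp0 i
    refine num_levels hpi hK2 hi (h2Rint.trans ?_) hd0.le hdLD
    apply mul_le_mul_of_nonneg_left _ (by positivity); linarith
  have hX : F.tstarc I cap v - (I.margin : ℤ) = F.tstarc I cap v := by rw [hmargin]; simp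
  obtain ⟨αd, hαd, hcd, hmd, honed, hρd, hltd, herrd⟩ :=
    descend_sem hdeg hσ₂ ε hε hab hab1 hθ hred hprod hcap hprec hord hordm hp0 hLT hlev (F.tstarc I cap v)
      hαE hcE hmE honeE herrE (by linarith) (by exact_mod_cast hhi.le)
  have hc0q : F.c0q I cap v = F.descend I cap (F.tstarc I cap v) (F.bEc I cap v) := by unfold WalkFns.c0q; rw [hX]
  -- (5) the baby steps
  have hαdA : αd ∈ posRelMinima σ₁ σ₂ A := by
    have h := mul_mem_posRelMinima hαd honed
    rwa [mul_one, spanSingleton_mul_spanSingleton_inv_mul ((map_ne_zero σ₁).mp hαd.ne')] at h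
  have hbudget := num_baby_budget (Bb := I.Bb) h9 hKN48 hLBKN hL0 hBb hC
  obtain ⟨n, hcn, hmn, hadv, hnC, hρn, hltn, hln⟩ :=
    babySteps_sem hdeg hσ₂ ε hε hab hab1 hθ hred hcap v hαdA (h6 A hA0 αd hαdA) (st := F.c0q I cap v)
      (by rw [hc0q]; exact hcd) (fun φ => by rw [hc0q, voronoiChain_zero]; exact hmd φ) (by rw [hc0q]; exact hρd)
      (C := ((F.ladder I cap 0).2 : ℝ) + I.KInt) (by rw [hc0q]; exact hltd.le) hbudget
  have hnmax := num_nmax h9 hKN48 hLBKN hL0 hC hnC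
  set β : K := voronoiChain σ₁ σ₂ A αd n with hβ
  have hβmem : β ∈ posRelMinima σ₁ σ₂ A := voronoiChain_mem hdeg hσ₂ ε hε hαdA n
  have hsucc : voronoiSucc σ₁ σ₂ A β = voronoiChain σ₁ σ₂ A αd (n + 1) := by
    rw [hβ, ← voronoiChain_succ hdeg hσ₂ ε hε hαdA]
  -- read the conclusions on `cfinq = babyStepc^[Bb] c0q` (definitional)
  have hcn' : Canon (F.cfinq I cap v).1 := hcn
  have hmn' : ∀ φ : K, Mem θ I.b (F.cfinq I cap v).1 φ ↔ φ ∈ FractionalIdeal.spanSingleton (𝓞 K)⁰ β⁻¹ * A := hmn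
  have hρn' : 0 ≤ F.tstarc I cap v - (F.cfinq I cap v).2 := hρn
  have hltn' : F.tstarc I cap v - (F.cfinq I cap v).2 < (F.redc I cap (F.cfinq I cap v).1).2 := hltn
  have hln' : |((F.redc I cap (F.cfinq I cap v).1).2 : ℝ) - 2 ^ I.prec *
      (Real.log (σ₁ (voronoiChain σ₁ σ₂ A αd (n + 1))) - Real.log (σ₁ β))| ≤ 1 := hln
  have hadv' : |(((F.cfinq I cap v).2 - (F.c0q I cap v).2 : ℤ) : ℝ) - 2 ^ I.prec *
      (Real.log (σ₁ β) - Real.log (σ₁ αd))| ≤ n := by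
    rw [voronoiChain_zero] at hadv; exact hadv
  rw [← hc0q] at herrd
  refine ⟨β, N, n, hβmem, hcn', hmn', hnmax, ?_, hρn', Int.cast_lt.mpr hltn', hsucc ▸ hln', hN, ?_⟩
  · -- the position budget
    have e : ((F.cfinq I cap v).2 : ℝ) = (((F.cfinq I cap v).2 - (F.c0q I cap v).2 : ℤ) : ℝ) + (F.c0q I cap v).2 := by
      push_cast; ring
    rw [e, abs_le]
    rw [abs_le] at hadv' herrd
    constructor <;> linarith [hadv'.1, hadv'.2, herrd.1, herrd.2]
  · -- the drift of the wrap count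
    have hRpos : (0 : ℝ) < I.Rint := by exact_mod_cast hRint0
    have h1 : |(N : ℝ) * I.Rint - (F.bEc I cap v).2| ≤ 2 * I.Rint := by
      have eN : (N : ℝ) * I.Rint = (F.tstarc I cap v : ℝ) - I.tgt v := by
        have := congrArg (fun z : ℤ => (z : ℝ)) hN; push_cast at this; linarith
      rw [eN, abs_le]
      have hlo' : (I.Rint : ℝ) ≤ (F.tstarc I cap v : ℝ) - (F.bEc I cap v).2 := by exact_mod_cast hlo
      have hhi' : (F.tstarc I cap v : ℝ) - (F.bEc I cap v).2 < 2 * I.Rint := by exact_mod_cast hhi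
      have htgt0 : (0 : ℝ) ≤ I.tgt v := by positivity
      have htgt' : (I.tgt v : ℝ) < I.Rint := by exact_mod_cast htgt
      constructor <;> linarith
    have h2 : |((F.bEc I cap v).2 : ℝ) - 2 ^ I.prec * ∑ t ∈ Finset.range I.T, (I.digit v t : ℝ) * Real.log (σ₁ (γ t))| ≤
        3 * S + 2 ^ I.prec * (2 * LB) * S := by
      have e : ((F.bEc I cap v).2 : ℝ) - 2 ^ I.prec * ∑ t ∈ Finset.range I.T, (I.digit v t : ℝ) * Real.log (σ₁ (γ t)) =
          (((F.bEc I cap v).2 : ℝ) - 2 ^ I.prec * Real.log (σ₁ αE)) +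
            2 ^ I.prec * (Real.log (σ₁ αE) - ∑ t ∈ Finset.range I.T, (I.digit v t : ℝ) * Real.log (σ₁ (γ t))) := by ring
      rw [e]
      refine (abs_add_le _ _).trans ?_
      rw [abs_mul, abs_of_pos (by positivity : (0 : ℝ) < 2 ^ I.prec)]
      have h3 := mul_le_mul_of_nonneg_left hdrE (by positivity : (0 : ℝ) ≤ 2 ^ I.prec)
      have h4 : (2 : ℝ) ^ I.prec * (2 * Real.log (3 * Real.sqrt |(discr K : ℝ)|) * S) = 2 ^ I.prec * (2 * LB) * S := by
        rw [hLB]; ring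
      linarith [herrE, h3, h4]
    -- divide by `Rint`
    have key : |(N : ℝ) - 2 ^ I.prec * (∑ t ∈ Finset.range I.T, (I.digit v t : ℝ) * Real.log (σ₁ (γ t))) / I.Rint| *
        I.Rint ≤ 2 * I.Rint + (3 * S + 2 ^ I.prec * (2 * LB) * S) := by
      rw [← abs_of_pos hRpos, ← abs_mul, abs_of_pos hRpos, sub_mul, div_mul_cancel₀ _ hRpos.ne']
      rw [show (N : ℝ) * I.Rint - 2 ^ I.prec * ∑ t ∈ Finset.range I.T, (I.digit v t : ℝ) * Real.log (σ₁ (γ t)) =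
          ((N : ℝ) * I.Rint - (F.bEc I cap v).2) +
            (((F.bEc I cap v).2 : ℝ) - 2 ^ I.prec * ∑ t ∈ Finset.range I.T, (I.digit v t : ℝ) * Real.log (σ₁ (γ t))) by ring]
      exact (abs_add_le _ _).trans (add_le_add h1 h2)
    rw [← le_div_iff₀ hRpos, add_div] at key
    have e2 : 2 * (I.Rint : ℝ) / I.Rint = 2 := by field_simp
    rw [e2] at key
    exact key

end Walk

/-- **P5b helper `classTableSem_walk_package`** (registered): the walk package of a table position. -/
theorem classTableSem_walk_package : ∀ (K : Type) [Field K] [NumberField K], Module.finrank ℚ K = 3 → ∀ (θ : K) (σ₁ : K →+* ℝ) (σ₂ : K →+* ℂ), (∃ z : K, starRingEnd ℂ (σ₂ z) ≠ σ₂ z) → ∀ (ε : (𝓞 K)ˣ), 1 < σ₁ (algebraMap (𝓞 K) K ε) → ∀ (F : CubicClassTable.WalkFns) (I : CubicClassTable.Inst), Squarefree (I.a * I.b) → I.a * I.b ≠ 1 → θ ^ 3 = ((I.a * I.b ^ 2 : ℕ) : K) → CubicClassTable.RedSem F I.a I.b K θ σ₁ σ₂ → CubicClassTable.ProdSpec I.a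 I.b K θ F.latProd → ∀ (cap : ℕ), (243 * I.a ^ 2 * I.b ^ 2) ^ 2 ≤ cap → 4 * Nat.size (I.a * I.b) + 8 ≤ I.prec → PureCubicCodes.Canon I.ord → (∀ φ : K, PureCubicCodes.Mem θ I.b I.ord φ ↔ IsIntegral ℤ φ) → (∀ A : FractionalIdeal (𝓞 K)⁰ K, A ≠ 0 → ∀ x₀ ∈ posRelMinima σ₁ σ₂ A, ∀ i : ℤ, 2 * σ₁ (voronoiChain σ₁ σ₂ A x₀ i) ≤ σ₁ (voronoiChain σ₁ σ₂ A x₀ (i + 6))) → Real.log 2 / 6 ≤ NumberField.Units.regulator K → I.s₀ = 18 * (10 * Nat.size (I.a * I.b) + 48) → 6 * Nat.size (27 * I.a ^ 2 * I.b ^ 2) + 16 ≤ I.Tdbl → 32 * (10 * Nat.size (I.a * I.b) + 48) ^ 2 ≤ I.Bb → I.margin = 0 → |(I.r : ℝ) - 2 ^ I.k * NumberField.Units.regulator K| ≤ 1 → 4 ≤ I.k → I.k + I.s ≤ I.prec → ∀ (v : ℕ) (𝔤 : ℕ → Ideal (𝓞 K)) (γ : ℕ → K), (∀ t < I.T, 𝔤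 t ≠ ⊥ ∧ PureCubicCodes.Canon (F.gT I v t) ∧ (∀ φ : K, PureCubicCodes.Mem θ I.b (F.gT I v t) φ ↔ φ ∈ (𝔤 t : FractionalIdeal (𝓞 K)⁰ K)) ∧ γ t ∈ (𝔤 t : FractionalIdeal (𝓞 K)⁰ K) ∧ 0 < σ₁ (γ t) ∧ ‖σ₂ (γ t)‖ < 1 ∧ (∀ φ : K, φ ∈ (𝔤 t : FractionalIdeal (𝓞 K)⁰ K) → 0 < σ₁ φ → ‖σ₂ φ‖ < 1 → σ₁ (γ t) ≤ σ₁ φ)) → ∃ (β : K) (N : ℤ) (n : ℕ), β ∈ posRelMinima σ₁ σ₂ (∏ t ∈ Finset.range I.T, (𝔤 t : FractionalIdeal (𝓞 K)⁰ K) ^ I.digit v t) ∧ PureCubicCodes.Canon (F.cfinq I cap v).1 ∧ (∀ φ : K, PureCubicCodes.Mem θ I.b (F.cfinq I cap v).1 φ ↔ φ ∈ FractionalIdeal.spanSingleton (𝓞 K)⁰ β⁻¹ * ∏ t ∈ Finset.range I.T, (𝔤 t : FractionalIdeal (𝓞 K)⁰ K) ^ I.digit v t) ∧ (n : ℝ)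 ≤ 20 * ((10 * Nat.size (I.a * I.b) + 48 : ℕ) : ℝ) ^ 2 ∧ |((F.cfinq I cap v).2 : ℝ) - 2 ^ I.prec * Real.log (σ₁ β)| ≤ 3 * (∑ t ∈ Finset.range I.T, (I.digit v t : ℝ)) + 3 * ((6 * Nat.size (27 * I.a ^ 2 * I.b ^ 2) + 9 : ℕ) + 1) * (2 ^ (6 * Nat.size (27 * I.a ^ 2 * I.b ^ 2) + 9) * ((I.s₀ : ℝ) + 1)) + n ∧ 0 ≤ F.tstarc I cap v - (F.cfinq I cap v).2 ∧ ((F.tstarc I cap v - (F.cfinq I cap v).2 : ℤ) : ℝ) < (F.redc I cap (F.cfinq I cap v).1).2 ∧ |((F.redc I cap (F.cfinq I cap v).1).2 : ℝ) - 2 ^ I.prec * (Real.log (σ₁ (voronoiSucc σ₁ σ₂ (∏ t ∈ Finset.range I.T, (𝔤 t : FractionalIdeal (𝓞 K)⁰ K) ^ I.digit v t) β)) - Real.log (σ₁ β))| ≤ 1 ∧ F.tstarc I cap v = I.tgt v + N * I.Rint ∧ |(N : ℝ) - 2 ^ I.prec * (∑ t ∈ Finset.range I.T, (I.digit v t : ℝ)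 * Real.log (σ₁ (γ t))) / I.Rint| ≤ 2 + (3 * (∑ t ∈ Finset.range I.T, (I.digit v t : ℝ)) + 2 ^ I.prec * (2 * Real.log (3 * Real.sqrt |(NumberField.discr K : ℝ)|)) * (∑ t ∈ Finset.range I.T, (I.digit v t : ℝ))) / I.Rint :=
  fun _ _ _ hdeg _ _ _ hσ₂ ε hε _ _ hab hab1 hθ hred hprod _ hcap hprec hord hordm h6 hR6 hs₀ hTdbl hBb hmargin hr hk4 hks v 𝔤 γ hslot =>
    walk_package hdeg hσ₂ ε hε hab hab1 hθ hred hprod hcap hprec hord hordm h6 hR6 hs₀ hTdbl hBb hmargin hr hk4 hks v 𝔤 γ hslot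


end Summit.QuantumAdvantage.QuantumAdvantage.Theorems.LinnikCubicClassGroups
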